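import Mathlib
import Summits.KontsevichZagierPeriods.Zeta5Search.WedgeDictionaryTopRelation
import Summits.KontsevichZagierPeriods.Zeta5Search.WedgeDictionaryConsequences
import HarnessLib

/-!
# The zero-slot STAR from the slot-7 four-term relation — configuration and scalars (fam-elim E-L25a)

HONEST FRAMING: systematic search; no irrationality claim unless certified.  Bookkeeping for
`Elimination/DictStarTopCore.lean` (cell `pub-zeta5`, fam-elim gen 25, 2026-08-21; OUR work, Summit side):

* the configuration points `cfg x u v t = x + u·e₁ + v·e₂ + t·e₇` of a base point `x : ℕ → ℤ` (level `x 0`,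
  slots `x 1 … x 7`), their slots, `d`, box membership, and their `bump`s;
* the coefficients of the STAR three-term relation derived there (slot pair `(1,7)`, `P = x + e₁ + e₇`), as
  polynomials in `x`: `aFac` (partner-shift factors of `coeff_update_sub`), `kapB = starKappa(P,1,7)`,
  `piB1, piB7` (the `π`-products) and the apex coefficient `lamB`;
* the two polynomial identities `scalarB0, scalarB1` among these and gen-1's Newton coefficients
  `topGamma0 … topGamma3` of the slot-7 telescoper (`WedgeDictionaryTopRelation`) — each one `ring`.

No cellular integral, no numerics, nothing moves a record.
-/

open Finset

namespace Summit.KontsevichZagierPeriods.Zeta5Search.Elimination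

open Summit.KontsevichZagierPeriods.Zeta5Search.DualSeries (InBox)
open Summit.KontsevichZagierPeriods.Zeta5Search.WedgeDictionary

/-! ## 1. The configuration `x + u·e₁ + v·e₂ + t·e₇` -/

/-- The point `x + u·e₁ + v·e₂ + t·e₇` (slots `1`, `2`, `7` shifted; level and the other slots unchanged). -/
def cfg (x : ℕ → ℤ) (u v t : ℤ) : ℕ → ℤ := fun k =>
  if k = 1 then x 1 + u else if k = 2 then x 2 + v else if k = 7 then x 7 + t else x k

/-- Level of a configuration point. -/
@[simp] theorem cfg_zero (x : ℕ → ℤ) (u v t : ℤ) : cfg x u v t 0 = x 0 := by simp [cfg]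

/-- Slot 1 of a configuration point. -/
@[simp] theorem cfg_one (x : ℕ → ℤ) (u v t : ℤ) : cfg x u v t 1 = x 1 + u := by simp [cfg]

/-- Slot 2 of a configuration point. -/
@[simp] theorem cfg_two (x : ℕ → ℤ) (u v t : ℤ) : cfg x u v t 2 = x 2 + v := by simp [cfg]

/-- Slot 7 of a configuration point. -/
@[simp] theorem cfg_seven (x : ℕ → ℤ) (u v t : ℤ) : cfg x u v t 7 = x 7 + t := by simp [cfg]

/-- The untouched slots of a configuration point. -/
theorem cfg_of_ne (x : ℕ → ℤ) (u v t : ℤ) {k : ℕ} (h1 : k ≠ 1) (h2 : k ≠ 2) (h7 : k ≠ 7) :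
    cfg x u v t k = x k := by simp [cfg, h1, h2, h7]

/-- The base point. -/
theorem cfg_base (x : ℕ → ℤ) : cfg x 0 0 0 = x := by
  funext k
  by_cases h1 : k = 1
  · subst h1; simp [cfg]
  by_cases h2 : k = 2
  · subst h2; simp [cfg]
  by_cases h7 : k = 7
  · subst h7; simp [cfg]
  exact cfg_of_ne x 0 0 0 h1 h2 h7

/-- Bumping slot 1. -/
theorem bump0_cfg (x : ℕ → ℤ) (u v t : ℤ) : bump (cfg x u v t) 0 = cfg x (u + 1) v t := by
  funext k
  by_cases h1 : k = 1
  · subst h1; simp [bump, cfg, add_assoc]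
  rw [bump_of_ne _ (show k ≠ 0 + 1 by omega)]
  by_cases h2 : k = 2
  · subst h2; simp [cfg]
  by_cases h7 : k = 7
  · subst h7; simp [cfg]
  rw [cfg_of_ne x _ _ _ h1 h2 h7, cfg_of_ne x _ _ _ h1 h2 h7]

/-- Bumping slot 2. -/
theorem bump1_cfg (x : ℕ → ℤ) (u v t : ℤ) : bump (cfg x u v t) 1 = cfg x u (v + 1) t := by
  funext k
  by_cases h2 : k = 2
  · subst h2; simp [bump, cfg, add_assoc]
  rw [bump_of_ne _ (show k ≠ 1 + 1 by omega)]
  by_cases h1 : k = 1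
  · subst h1; simp [cfg]
  by_cases h7 : k = 7
  · subst h7; simp [cfg]
  rw [cfg_of_ne x _ _ _ h1 h2 h7, cfg_of_ne x _ _ _ h1 h2 h7]

/-- Bumping slot 7. -/
theorem bump6_cfg (x : ℕ → ℤ) (u v t : ℤ) : bump (cfg x u v t) 6 = cfg x u v (t + 1) := by
  funext k
  by_cases h7 : k = 7
  · subst h7; simp [bump, cfg, add_assoc]
  rw [bump_of_ne _ (show k ≠ 6 + 1 by omega)]
  by_cases h1 : k = 1
  · subst h1; simp [cfg]
  by_cases h2 : k = 2
  · subst h2; simp [cfg]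
  rw [cfg_of_ne x _ _ _ h1 h2 h7, cfg_of_ne x _ _ _ h1 h2 h7]

/-- `x + e₇`, `x + 2e₇`, `x + 3e₇`, `x + e₁`, `x + e₂` as configuration points. -/
theorem bump_eq_cfg (x : ℕ → ℤ) :
    bump x 6 = cfg x 0 0 1 ∧ bump (bump x 6) 6 = cfg x 0 0 2 ∧ bump (bump (bump x 6) 6) 6 = cfg x 0 0 3 ∧
      bump x 0 = cfg x 1 0 0 ∧ bump x 1 = cfg x 0 1 0 := by
  have e7 : bump x 6 = cfg x 0 0 1 := by
    have h := bump6_cfg x 0 0 0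
    rwa [cfg_base, zero_add] at h
  refine ⟨e7, ?_, ?_, ?_, ?_⟩
  · rw [e7, bump6_cfg]; norm_num
  · rw [e7, bump6_cfg, bump6_cfg]; norm_num
  · have h := bump0_cfg x 0 0 0
    rwa [cfg_base, zero_add] at h
  · have h := bump1_cfg x 0 0 0
    rwa [cfg_base, zero_add] at h

/-- `d` of a configuration point. -/
theorem dOf_cfg (x : ℕ → ℤ) (u v t : ℤ) : dOf (cfg x u v t) = dOf x - u - v - t := by
  simp only [dOf, sum_range_succ, sum_range_zero, Nat.reduceAdd, cfg_zero, cfg_one, cfg_two, cfg_seven]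
  rw [cfg_of_ne x u v t (k := 3) (by omega) (by omega) (by omega),
    cfg_of_ne x u v t (k := 4) (by omega) (by omega) (by omega),
    cfg_of_ne x u v t (k := 5) (by omega) (by omega) (by omega),
    cfg_of_ne x u v t (k := 6) (by omega) (by omega) (by omega)]
  ring

/-- A configuration point with non-negative shifts staying below `x₀ + 1` is in the box. -/
theorem inBox_cfg (x : ℕ → ℤ) (hx : InBox x) {u v t : ℤ} (hu : 0 ≤ u) (hv : 0 ≤ v) (ht : 0 ≤ t)
    (h1 : x 1 + u ≤ x 0 + 1) (h2 : x 2 + v ≤ x 0 + 1) (h7 : x 7 + t ≤ x 0 + 1) : InBox (cfg x u v t) := by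
  refine ⟨by rw [cfg_zero]; exact hx.1, fun j hj => ?_⟩
  have hx1 := hx.2 0 (by simp)
  have hx2 := hx.2 1 (by simp)
  have hx7 := hx.2 6 (by simp)
  have hxj := hx.2 j hj
  simp only [Nat.reduceAdd] at hx1 hx2 hx7
  rw [cfg_zero]
  by_cases e1 : j + 1 = 1
  · rw [e1, cfg_one]; omega
  by_cases e2 : j + 1 = 2
  · rw [e2, cfg_two]; omega
  by_cases e7 : j + 1 = 7
  · rw [e7, cfg_seven]; omega
  rw [cfg_of_ne x u v t e1 e2 e7]
  exact hxj

/-- `coeff_update_sub` in `bump` notation. -/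
theorem cus_bump (b : ℕ → ℤ) (hb : InBox b) (hd : 0 ≤ dOf b) {i k : ℕ} (hi : i < 7) (hk : k < 7)
    (hli : b (i + 1) ≤ b 0) (hlk : b (k + 1) ≤ b 0) :
    coeffU (bump b i) - coeffU (bump b k) =
        ((b (i + 1) - b (k + 1)) * (b 0 - b (i + 1) - b (k + 1)) : ℚ) * coeffU b ∧
      coeffW (bump b i) - coeffW (bump b k) =
        ((b (i + 1) - b (k + 1)) * (b 0 - b (i + 1) - b (k + 1)) : ℚ) * coeffW b ∧
      coeffV (bump b i) - coeffV (bump b k) =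
        ((b (i + 1) - b (k + 1)) * (b 0 - b (i + 1) - b (k + 1)) : ℚ) * coeffV b :=
  coeff_update_sub b hb hd (mem_range.2 hi) (mem_range.2 hk) hli hlk

/-! ## 2. The coefficients of the slot-(1,7) STAR in terms of the base `x` -/

/-- `α_s^{(t)}(x) = (x_s − x₇ − t)(x₀ − x_s − x₇ − t)`: the partner-shift factor between the slot-`s` and the
slot-`7` bumps of `x + t·e₇`. -/
def aFac (x : ℕ → ℤ) (s : ℕ) (t : ℤ) : ℚ := ((x s : ℚ) - x 7 - t) * ((x 0 : ℚ) - x s - x 7 - t)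

/-- `κ_B = starKappa(P,1,7)` at `P = x + e₁ + e₇`: `(x₁ − x₇)(x₀ − 1 − x₁ − x₇)`. -/
def kapB (x : ℕ → ℤ) : ℚ := ((x 1 : ℚ) - x 7) * ((x 0 : ℚ) - 1 - x 1 - x 7)

/-- `π₁` at `P = x + e₁ + e₇`. -/
def piB1 (x : ℕ → ℤ) : ℚ :=
  ((x 1 : ℚ) + 1) * ((x 0 : ℚ) - 1 - x 1 - x 7) * (((x 0 : ℚ) - x 1 - x 2) * ((x 0 : ℚ) - x 1 - x 3) *
    ((x 0 : ℚ) - x 1 - x 4) * ((x 0 : ℚ) - x 1 - x 5) * ((x 0 : ℚ) - x 1 - x 6))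

/-- `π₇` at `P = x + e₁ + e₇`. -/
def piB7 (x : ℕ → ℤ) : ℚ :=
  ((x 7 : ℚ) + 1) * ((x 0 : ℚ) - 1 - x 1 - x 7) * (((x 0 : ℚ) - x 7 - x 2) * ((x 0 : ℚ) - x 7 - x 3) *
    ((x 0 : ℚ) - x 7 - x 4) * ((x 0 : ℚ) - x 7 - x 5) * ((x 0 : ℚ) - x 7 - x 6))

/-- The apex coefficient `λ_B` of (4T_B). -/
def lamB (x : ℕ → ℤ) : ℚ := kapB x * (topGamma2 x + ((dOf x : ℚ) - 1) * aFac x 1 2)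

/-! ## 3. The two polynomial identities among the Newton coefficients (one `ring` each) -/

/-- `d(x) − 1 = −γ₃(x)` (`topGamma3_eq`). -/
theorem dOf_sub_one_eq (x : ℕ → ℤ) : ((dOf x : ℚ) - 1) = -topGamma3 x := by
  rw [topGamma3_eq]; ring

/-- (f0_B): the coefficient of `f(x)`, second slot `7`. -/
theorem scalarB0 (x : ℕ → ℤ) : -piB7 x * aFac x 1 0 + kapB x * topGamma0 x = 0 := by
  simp only [piB7, aFac, kapB, topGamma0, topA0, topA1, topA2, topA3, yNode, fe1, fe2, fe3, fe4, fe5, fe6]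
  push_cast
  ring

/-- (f1_B): the coefficient of `f(x+e₇)`, second slot `7`. -/
theorem scalarB1 (x : ℕ → ℤ) : -lamB x * aFac x 1 1 - piB7 x + piB1 x + kapB x * topGamma1 x = 0 := by
  simp only [lamB, dOf_sub_one_eq]
  simp only [piB1, piB7, aFac, kapB, topGamma1, topGamma2, topGamma3, topA1, topA2, topA3, yNode, fe1, fe2,
    fe3, fe4, fe5]
  push_cast
  ring

end Summit.KontsevichZagierPeriods.Zeta5Search.Elimination
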